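import Summits.QuantumFields.YangMills.Theorems.UnitScaleTiltProp7DivSliceOfMemberDivSq
import Summits.QuantumFields.YangMills.Theorems.UnitScaleTiltProp7CovAgmonLetters
import HarnessLib

/-!
# Route `UnitScaleTilt`, crux «MinimiserStabilityRegPr» (stmt-QuantumFields-19200), E′ ∕ (N06) LANE II «DIVERGENCE RECOVERY AT CURVED `W`» — brick (B6), rows 1–2:
# THE COMMUTATORS OF THE MEMBER'S COVARIANT GRADIENT `D_W` AND COVARIANT LAPLACIAN `Δ_W = D*_W D_W` WITH A REAL SCALAR CUTOFF `ζ`, LOCALISED TO THE CUTOFF'S TRANSITION SET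

Cell `ym3-torus`, width seat `ym3-torus-px11` (gen 6); ★★OWNER RULING №23 (c) «(B6) p.o.u. + commutator rows → idle width», px11 g6 «(B6) MINE» + LOCATE-B6-POU-px11g6
(fcd9ef01) §2.  THEOREMS ONLY (0 `def`, 0 `sorry`); `--supports stmt-QuantumFields-19200`, count-neutral.  YM₃ on T³ is a ladder rung (R3), not the Clay problem; nothing here
claims (V3), `hN06`, a stub, the crux, d = 4 or the mass gap.

THE POINT.  Lane II's assembly (★p1 g19 SKELETON v1.1 §5 (B6)∕(B7), px4 g7 LOCATE #60 S3) localises the divergence-recovery estimate with a partition of unity `ζ_i` at scale `R`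
blocks and pays for it with commutators.  For a REAL scalar multiplier `ζ` the two differential commutators are EXACT Leibniz identities — the background `W` enters only through
the unitary transporters `Ad(W_b)`, so NO regularity (`RegPr`) and NO window is needed:
* `D_W(ζλ)(b) − ζ(b₋)·D_Wλ(b) = η⁻¹(ζ(b₊) − ζ(b₋))·Ad(W_b)λ(b₊)` (✓ `Prop7CovAgmonLetters.covD_smul_fun_src` read through ✓ `Prop7LandauDict.DL2_toL2S_eq_covDerivFwdT`);
* `[Δ_W, ζ]λ(x) = η⁻²·Σ_μ((ζ(x) − ζ(x−e_μ))D*_μλ(x) − (ζ(x+e_μ) − ζ(x))D_μλ(x) − (∂²_μζ)(x)λ(x))` (✓ `Prop7ConjFrameTransport.divB_covD_smul_fun`, bounded entrywise by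
  ✓ `Prop7CovAgmonLetters.hs_weighted_comm_le` at `θ = ω = 1`), read through `covLapSite = DstarL2 ∘ DL2` and the (DV) dictionary ✓ `Prop7DivSliceOfMemberDivSq.DstarL2_toL2_eq_toL2S`.
Both commutators VANISH at sites where `ζ` is locally constant, so their weighted `L²` norms are sums over any finite set `S` containing the transition set of `ζ` — the
«`‖·‖_{Ω_i}`» of the skeleton, written as indicator-free `Finset` sums on the function side (Frobenius entries, weight `c₀`, `η⁻¹ = L^{K−n}`).

WHAT IS PROVED (ns `…Theorems.Prop7Lane2CutoffCommutators`; member `F n K`, weight `c₀ > 0`, ANY background `W`, ANY real `ζ`, `hs X = Σ_{jk}|X_{jk}|²`):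
* §1 letters: `coe_bgUnits_mem_unitary`, `toL2S_symm_covLapSite_toL2S` (`Δ_W` on the functions `= η⁻²·divB_W(D_W ·)`), `sum_pbond_tgt` (re-indexing bonds by their targets).
* §2 ROW 2: ★ `DL2_smul_sub_smul_apply` (the Leibniz identity), ★ `norm_sq_DL2_smul_sub_eq` (`= c₀η⁻²Σ_b(ζ(b₊)−ζ(b₋))²hs(λ(b₊))`, EXACT),
  ★★ `norm_sq_DL2_smul_sub_le` (`≤ 3a²·η⁻²·c₀Σ_{x∈S}hs(λ(x))` under `|ζ(x+e_μ) − ζ(x)| ≤ a` and «targets of non-constant bonds lie in `S`»).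
* §3 ROW 1: ★ `covLapSite_comm_apply` (the commutator on the functions), `covLapSite_comm_apply_eq_zero` (vanishing off the transition set),
  ★★ `norm_sq_covLapSite_comm_le` (`≤ 9η⁻⁴·c₀·Σ_{x∈S}Σ_μ[a²hs(D_μλ(x−e_μ)) + a²hs(D_μλ(x)) + a₂²hs(λ(x))]` under the step row `a` and the second-difference
  row `a₂`; `hs(D*_μλ(x)) = hs(D_μλ(x − e_μ))` by unitarity, so only FORWARD covariant differences on `S ∪ (S − e_μ)` appear).
At the skeleton's rows: `a = 2(Rℓ)⁻¹`, `a₂ = 8(Rℓ)⁻²`, `η⁻¹ = ℓ` ⇒ `Cζ`-rows with `a²η⁻² = 4R⁻²`, `a₂²η⁻⁴ = 64R⁻⁴` — ABSOLUTE.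
HONEST SCOPE.  Two Leibniz rows and their norms; the p.o.u. itself (B6-a) and the averaging commutator (B6-c, on `RegPr`) are separate files; nothing of (V3)∕(B7) is claimed.

References: T. Bałaban, CMP 99 (1985) 389–434 [Balaban1985BackgroundPropagators] ((3.3) p.391, (3.8) p.392, (3.11) p.392, (3.23) p.394); CMP 96 (1984) 223–250
[Balaban1984PropagatorsII] (p.238: «the terms with the commutator … give a factor O(M⁻¹)»); the product rule ∕ first-order commutators `[D*D, h]` are (3.100) pp.413–414 of the former.
-/

set_option autoImplicit false

noncomputable section

open scoped BigOperators Matrix.Norms.L2Operator Matrix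

namespace Summit.QuantumFields.YangMills.Theorems.Prop7Lane2CutoffCommutators

open Literature.MathematicalPhysics.QuantumFieldTheory.Balaban1983to89
open Literature.MathematicalPhysics.QuantumFieldTheory.Balaban1983to89.T3ContinuumYM3Torus
open T3SectALandauChart (covDerivFwdT bgUnits eta eta_pos)
open B10Eq27TorusAxialLog (unitsField toUField)
open B9Eq39Adjoint (R covD covDstar divB covDstar_smul)
open B9TorusCalculus (torusT torusT_apply torusT_symm_apply)
open Summit.QuantumFields.YangMills.Theorems.Prop7SectET3HilbertLetters (W₂ toL2 toL2S DL2 DstarL2 covLapSite)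
open Summit.QuantumFields.YangMills.Theorems.Prop7SecondOrderDict (covDerivFwdT_eq_smul_covD)
open Summit.QuantumFields.YangMills.Theorems.Prop7LandauDict (DL2_toL2S_eq_covDerivFwdT inv_coe_smul_eq)
open Summit.QuantumFields.YangMills.Theorems.Prop7DivSliceOfMemberDivSq (DstarL2_toL2_eq_toL2S inv_eta_sq_eq)
open Summit.QuantumFields.YangMills.Theorems.Prop7LaplaceAFlatLetters (norm_sq_toL2 norm_sq_toL2S)
open Summit.QuantumFields.YangMills.Theorems.Prop7CovariantCoercivity (sum_norm_sq_R)
open Summit.QuantumFields.YangMills.Theorems.Prop7CovAgmonLetters (hs_smul covD_smul_fun_src hs_weighted_comm_le hs_covDstar_eq)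
open Summit.QuantumFields.YangMills.Theorems.Prop7ConjFrameTransport (divB_covD_smul_fun)
open Summit.QuantumFields.YangMills.Theorems.Prop7FlatCoercivity (sum_shift)

variable (F : T3Family) (n K : ℕ) (c₀ : ℝ)

/-! ## §1 Letters -/

/-- The background read in units is unitary: `↑(W♭ b) ∈ U(2)`. [cite: Balaban1985Averaging, (19) p.21] -/
theorem coe_bgUnits_mem_unitary (W : GaugeField (F.P K) 0 (Matrix.specialUnitaryGroup (Fin 2) ℂ)) (μ : Fin 3) (x : Site (F.P K) 0) :
    ((bgUnits F K W ⟨x, μ⟩ : (Matrix (Fin 2) (Fin 2) ℂ)ˣ) : Matrix (Fin 2) (Fin 2) ℂ) ∈ unitary (Matrix (Fin 2) (Fin 2) ℂ) :=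
  (W ⟨x, μ⟩).2.1

/-- The same, bond-indexed. [cite: Balaban1985Averaging, (19) p.21] -/
theorem coe_bgUnits_mem_unitary' (W : GaugeField (F.P K) 0 (Matrix.specialUnitaryGroup (Fin 2) ℂ)) (b : PBond (F.P K) 0) :
    ((bgUnits F K W b : (Matrix (Fin 2) (Fin 2) ℂ)ˣ) : Matrix (Fin 2) (Fin 2) ℂ) ∈ unitary (Matrix (Fin 2) (Fin 2) ℂ) :=
  (W b).2.1

/-- Re-indexing a sum over bonds by (direction, TARGET): `Σ_b g(b.dir, b₊) = Σ_μ Σ_x g(μ, x)`. [folklore] -/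
theorem sum_pbond_tgt (g : Fin 3 → Site (F.P K) 0 → ℝ) :
    ∑ b : PBond (F.P K) 0, g b.dir b.tgt = ∑ μ : Fin 3, ∑ x : Site (F.P K) 0, g μ x := by
  rw [B10StarCount.sum_pbond, Finset.sum_comm]
  refine Finset.sum_congr rfl fun μ _ => ?_
  exact sum_shift (P := F.P K) μ (g μ)

variable [Fact (0 < c₀)]

/-- **`Δ_W` ON THE FUNCTIONS**: `(toL2S)⁻¹(covLapSite W (toL2S λ))(x) = η⁻²·divB_W(μ ↦ D_{W,μ}λ)(x)` in lit-balaban's `torusT` letters (`covLapSite = D*_W ∘ D_W`, ✓`DL2_toL2S_eq_toL2_covDη`,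
✓`DstarL2_toL2_eq_toL2S`). [cite: Balaban1985BackgroundPropagators, (3.23) p.394, (3.3) p.391, (3.8) p.392] -/
theorem toL2S_symm_covLapSite_toL2S (W : GaugeField (F.P K) 0 (Matrix.specialUnitaryGroup (Fin 2) ℂ)) (l : Site (F.P K) 0 → Matrix (Fin 2) (Fin 2) ℂ)
    (x : Site (F.P K) 0) :
    (toL2S F K c₀).symm (covLapSite F n K c₀ W (toL2S F K c₀ l)) x
      = ((eta F n K)⁻¹) ^ 2 • divB (torusT (F.P K) 0) (fun μ z => bgUnits F K W ⟨z, μ⟩)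
          (fun μ => covD (torusT (F.P K) 0) (fun μ z => bgUnits F K W ⟨z, μ⟩) μ l) x := by
  -- `D_W` on the functions: `η⁻¹·D¹_W`
  have hDL : DL2 F n K c₀ W (toL2S F K c₀ l)
      = toL2 F K c₀ (fun b => (eta F n K)⁻¹ • covD (torusT (F.P K) 0) (fun μ z => bgUnits F K W ⟨z, μ⟩) b.dir l b.src) := by
    apply (toL2 F K c₀).symm.injective
    rw [LinearEquiv.symm_apply_apply]
    funext b
    rw [DL2_toL2S_eq_covDerivFwdT, covDerivFwdT_eq_smul_covD]
  rw [covLapSite, LinearMap.comp_apply, hDL, DstarL2_toL2_eq_toL2S, LinearEquiv.symm_apply_apply]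
  -- pull the inner `η⁻¹` out of `divB`
  show (eta F n K)⁻¹ • divB (torusT (F.P K) 0) (fun κ z => bgUnits F K W ⟨z, κ⟩)
      (fun κ z => (eta F n K)⁻¹ • covD (torusT (F.P K) 0) (fun μ y => bgUnits F K W ⟨y, μ⟩) κ l z) x = _
  have hdiv : divB (torusT (F.P K) 0) (fun κ z => bgUnits F K W ⟨z, κ⟩)
      (fun κ z => (eta F n K)⁻¹ • covD (torusT (F.P K) 0) (fun μ y => bgUnits F K W ⟨y, μ⟩) κ l z) x
      = (eta F n K)⁻¹ • divB (torusT (F.P K) 0) (fun κ z => bgUnits F K W ⟨z, κ⟩)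
          (fun μ => covD (torusT (F.P K) 0) (fun μ z => bgUnits F K W ⟨z, μ⟩) μ l) x := by
    simp only [divB, Finset.smul_sum]
    refine Finset.sum_congr rfl fun μ _ => ?_
    rw [← inv_coe_smul_eq, ← covDstar_smul]
    congr 1
    funext z
    exact (inv_coe_smul_eq _ _).symm
  rw [hdiv, smul_smul, sq]

/-! ## §2 ★ ROW 2 — the gradient commutator `D_W(ζλ) − ζ(b₋)·D_Wλ` -/

section Row2

variable (W : GaugeField (F.P K) 0 (Matrix.specialUnitaryGroup (Fin 2) ℂ)) (ζ : Site (F.P K) 0 → ℝ) (l : Site (F.P K) 0 → Matrix (Fin 2) (Fin 2) ℂ)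

/-- ★ **LEIBNIZ FOR `D_W` WITH A SCALAR AT THE SOURCE**: `D_W(ζλ)(b) − ζ(b₋)·D_Wλ(b) = (η⁻¹(ζ(b₊) − ζ(b₋)))·Ad(W_b)λ(b₊)`. [cite: Balaban1985BackgroundPropagators, (3.3) p.391] -/
theorem DL2_smul_sub_smul_apply (b : PBond (F.P K) 0) :
    (toL2 F K c₀).symm (DL2 F n K c₀ W (toL2S F K c₀ (fun x => ζ x • l x))) b - ζ b.src • (toL2 F K c₀).symm (DL2 F n K c₀ W (toL2S F K c₀ l)) b
      = ((eta F n K)⁻¹ * (ζ b.tgt - ζ b.src)) • R (bgUnits F K W b) (l b.tgt) := by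
  rw [DL2_toL2S_eq_covDerivFwdT, DL2_toL2S_eq_covDerivFwdT, covDerivFwdT_eq_smul_covD, covDerivFwdT_eq_smul_covD,
    covD_smul_fun_src (fun μ z => bgUnits F K W ⟨z, μ⟩) ζ l b.dir b.src, torusT_apply]
  change _ = ((eta F n K)⁻¹ * (ζ (b.src.shift b.dir) - ζ b.src)) • R (bgUnits F K W ⟨b.src, b.dir⟩) (l (b.src.shift b.dir))
  rw [smul_add, smul_smul, smul_smul, smul_smul, mul_comm (ζ b.src) ((eta F n K)⁻¹), add_sub_cancel_left]

/-- The commutator as ONE `toL2` image (linearity of the transports). [cite: Balaban1985BackgroundPropagators, (3.3) p.391, (3.11) p.392] -/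
theorem DL2_smul_sub_smul_eq_toL2 :
    DL2 F n K c₀ W (toL2S F K c₀ (fun x => ζ x • l x)) - toL2 F K c₀ (fun b => ζ b.src • (toL2 F K c₀).symm (DL2 F n K c₀ W (toL2S F K c₀ l)) b)
      = toL2 F K c₀ (fun b => ((eta F n K)⁻¹ * (ζ b.tgt - ζ b.src)) • R (bgUnits F K W b) (l b.tgt)) := by
  apply (toL2 F K c₀).symm.injective
  rw [map_sub, LinearEquiv.symm_apply_apply, LinearEquiv.symm_apply_apply]
  funext b
  rw [Pi.sub_apply]
  exact DL2_smul_sub_smul_apply F n K c₀ W ζ l b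

/-- ★ **THE NORM OF THE GRADIENT COMMUTATOR, EXACTLY**: `‖D_W(ζλ) − ζ(·₋)·D_Wλ‖² = c₀·η⁻²·Σ_b (ζ(b₊) − ζ(b₋))²·hs(λ(b₊))` (`Ad(W_b)` unitary, Frobenius-isometric).
[cite: Balaban1985BackgroundPropagators, (3.3) p.391, (3.11) p.392] -/
theorem norm_sq_DL2_smul_sub_eq :
    ‖DL2 F n K c₀ W (toL2S F K c₀ (fun x => ζ x • l x)) - toL2 F K c₀ (fun b => ζ b.src • (toL2 F K c₀).symm (DL2 F n K c₀ W (toL2S F K c₀ l)) b)‖ ^ 2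
      = c₀ * ((eta F n K)⁻¹) ^ 2 * ∑ b : PBond (F.P K) 0, (ζ b.tgt - ζ b.src) ^ 2 * ∑ j : Fin 2, ∑ k : Fin 2, ‖l b.tgt j k‖ ^ 2 := by
  rw [DL2_smul_sub_smul_eq_toL2, norm_sq_toL2, mul_assoc]
  congr 1
  rw [Finset.mul_sum]
  refine Finset.sum_congr rfl fun b _ => ?_
  rw [hs_smul (N := 2), sum_norm_sq_R (coe_bgUnits_mem_unitary' F K W b)]
  ring

/-- ★★ **ROW 2, LOCALISED**: if `|ζ(x+e_μ) − ζ(x)| ≤ a` everywhere and every bond along which `ζ` changes has its TARGET in `S`, then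
`‖D_W(ζλ) − ζ(·₋)·D_Wλ‖² ≤ 3·a²·η⁻²·(c₀·Σ_{x∈S} hs(λ(x)))`.  (Skeleton (B6) row 2 with `a = 2(Rℓ)⁻¹`, `η⁻¹ = ℓ`: `Cζ² = 12`.) [cite: Balaban1985BackgroundPropagators, (3.3) p.391, (3.100) pp.413–414; Balaban1984PropagatorsII, p.238] -/
theorem norm_sq_DL2_smul_sub_le {a : ℝ} (S : Finset (Site (F.P K) 0)) (hζ1 : ∀ (x : Site (F.P K) 0) (μ : Fin 3), |ζ (x.shift μ) - ζ x| ≤ a)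
    (hζS : ∀ (x : Site (F.P K) 0) (μ : Fin 3), ζ (x.shift μ) ≠ ζ x → x.shift μ ∈ S) :
    ‖DL2 F n K c₀ W (toL2S F K c₀ (fun x => ζ x • l x)) - toL2 F K c₀ (fun b => ζ b.src • (toL2 F K c₀).symm (DL2 F n K c₀ W (toL2S F K c₀ l)) b)‖ ^ 2
      ≤ 3 * a ^ 2 * ((eta F n K)⁻¹) ^ 2 * (c₀ * ∑ x ∈ S, ∑ j : Fin 2, ∑ k : Fin 2, ‖l x j k‖ ^ 2) := by
  have hc : (0 : ℝ) < c₀ := Fact.out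
  rw [norm_sq_DL2_smul_sub_eq]
  -- termwise: `(ζ(b₊) − ζ(b₋))²·hs(λ(b₊)) ≤ a²·𝟙_S(b₊)·hs(λ(b₊))`
  have hterm : ∀ b : PBond (F.P K) 0, (ζ b.tgt - ζ b.src) ^ 2 * ∑ j : Fin 2, ∑ k : Fin 2, ‖l b.tgt j k‖ ^ 2
      ≤ a ^ 2 * (if b.tgt ∈ S then ∑ j : Fin 2, ∑ k : Fin 2, ‖l b.tgt j k‖ ^ 2 else 0) := by
    intro b
    have hhs : 0 ≤ ∑ j : Fin 2, ∑ k : Fin 2, ‖l b.tgt j k‖ ^ 2 := Finset.sum_nonneg fun _ _ => Finset.sum_nonneg fun _ _ => sq_nonneg _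
    by_cases hb : ζ b.tgt = ζ b.src
    · rw [hb, sub_self, zero_pow two_ne_zero, zero_mul]
      split_ifs <;> nlinarith [sq_nonneg a]
    · have hmem : b.tgt ∈ S := hζS b.src b.dir hb
      rw [if_pos hmem]
      have h1 : (ζ b.tgt - ζ b.src) ^ 2 ≤ a ^ 2 := by
        have := hζ1 b.src b.dir
        rw [← sq_abs]; exact pow_le_pow_left₀ (abs_nonneg _) this 2
      exact mul_le_mul_of_nonneg_right h1 hhs
  have hsum := Finset.sum_le_sum fun b (_ : b ∈ (Finset.univ : Finset (PBond (F.P K) 0))) => hterm b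
  rw [← Finset.mul_sum, sum_pbond_tgt F K (fun _ x => if x ∈ S then ∑ j : Fin 2, ∑ k : Fin 2, ‖l x j k‖ ^ 2 else 0), Finset.sum_const, Finset.card_univ,
    Fintype.card_fin, nsmul_eq_mul, Finset.sum_ite_mem, Finset.univ_inter, Nat.cast_ofNat] at hsum
  have hη : 0 ≤ c₀ * ((eta F n K)⁻¹) ^ 2 := by positivity
  calc c₀ * ((eta F n K)⁻¹) ^ 2 * ∑ b : PBond (F.P K) 0, (ζ b.tgt - ζ b.src) ^ 2 * ∑ j : Fin 2, ∑ k : Fin 2, ‖l b.tgt j k‖ ^ 2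
      ≤ c₀ * ((eta F n K)⁻¹) ^ 2 * (a ^ 2 * (3 * ∑ x ∈ S, ∑ j : Fin 2, ∑ k : Fin 2, ‖l x j k‖ ^ 2)) := mul_le_mul_of_nonneg_left hsum hη
    _ = _ := by ring

end Row2

/-! ## §3 ★ ROW 1 — the Laplacian commutator `[Δ_W, ζ]` -/

section Row1

variable (W : GaugeField (F.P K) 0 (Matrix.specialUnitaryGroup (Fin 2) ℂ)) (ζ : Site (F.P K) 0 → ℝ) (l : Site (F.P K) 0 → Matrix (Fin 2) (Fin 2) ℂ)

/-- ★ **THE LAPLACIAN COMMUTATOR ON THE FUNCTIONS**: `(toL2S)⁻¹(Δ_W(ζλ))(x) − ζ(x)·(toL2S)⁻¹(Δ_Wλ)(x) = η⁻²·(divB_W D_W(ζλ)(x) − ζ(x)·divB_W D_Wλ(x))`.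
[cite: Balaban1985BackgroundPropagators, (3.23) p.394] -/
theorem covLapSite_comm_apply (x : Site (F.P K) 0) :
    (toL2S F K c₀).symm (covLapSite F n K c₀ W (toL2S F K c₀ (fun z => ζ z • l z))) x - ζ x • (toL2S F K c₀).symm (covLapSite F n K c₀ W (toL2S F K c₀ l)) x
      = ((eta F n K)⁻¹) ^ 2 •
          (divB (torusT (F.P K) 0) (fun μ z => bgUnits F K W ⟨z, μ⟩)
              (fun μ => covD (torusT (F.P K) 0) (fun μ z => bgUnits F K W ⟨z, μ⟩) μ (fun z => ζ z • l z)) x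
            - ζ x • divB (torusT (F.P K) 0) (fun μ z => bgUnits F K W ⟨z, μ⟩)
                (fun μ => covD (torusT (F.P K) 0) (fun μ z => bgUnits F K W ⟨z, μ⟩) μ l) x) := by
  rw [toL2S_symm_covLapSite_toL2S, toL2S_symm_covLapSite_toL2S, smul_sub, smul_comm (ζ x)]

/-- The commutator VANISHES where `ζ` is locally constant (all six first differences at `x` zero). [cite: Balaban1985BackgroundPropagators, (3.100) pp.413–414; Balaban1984PropagatorsII, p.238] -/
theorem covLapSite_comm_apply_eq_zero (x : Site (F.P K) 0) (hx : ∀ μ : Fin 3, ζ (x.shift μ) = ζ x ∧ ζ (x.unshift μ) = ζ x) :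
    (toL2S F K c₀).symm (covLapSite F n K c₀ W (toL2S F K c₀ (fun z => ζ z • l z))) x - ζ x • (toL2S F K c₀).symm (covLapSite F n K c₀ W (toL2S F K c₀ l)) x = 0 := by
  rw [covLapSite_comm_apply, divB_covD_smul_fun, add_sub_cancel_left]
  have h0 : ∀ μ : Fin 3, (ζ x - ζ ((torusT (F.P K) 0 μ).symm x)) • covDstar (torusT (F.P K) 0) (fun μ z => bgUnits F K W ⟨z, μ⟩) μ l x
      - (ζ (torusT (F.P K) 0 μ x) - ζ x) • covD (torusT (F.P K) 0) (fun μ z => bgUnits F K W ⟨z, μ⟩) μ l x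
      - ((ζ (torusT (F.P K) 0 μ x) - ζ x) - (ζ x - ζ ((torusT (F.P K) 0 μ).symm x))) • l x = 0 := by
    intro μ
    simp only [torusT_apply, torusT_symm_apply, (hx μ).1, (hx μ).2, sub_self, zero_smul]
  simp only [h0, Finset.sum_const_zero, smul_zero]

/-- The commutator as ONE `toL2S` image. [cite: Balaban1985BackgroundPropagators, (3.23) p.394] -/
theorem covLapSite_comm_eq_toL2S :
    covLapSite F n K c₀ W (toL2S F K c₀ (fun z => ζ z • l z)) - toL2S F K c₀ (fun x => ζ x • (toL2S F K c₀).symm (covLapSite F n K c₀ W (toL2S F K c₀ l)) x)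
      = toL2S F K c₀ (fun x => (toL2S F K c₀).symm (covLapSite F n K c₀ W (toL2S F K c₀ (fun z => ζ z • l z))) x
          - ζ x • (toL2S F K c₀).symm (covLapSite F n K c₀ W (toL2S F K c₀ l)) x) := by
  apply (toL2S F K c₀).symm.injective
  rw [map_sub, LinearEquiv.symm_apply_apply, LinearEquiv.symm_apply_apply]
  rfl

/-- ★★ **ROW 1, LOCALISED**: under the step row `|ζ(x±e_μ) − ζ(x)| ≤ a`, the second-difference row `|ζ(x+e_μ) + ζ(x−e_μ) − 2ζ(x)| ≤ a₂`, and «every site where `ζ` is NOT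
locally constant lies in `S`»:
`‖[Δ_W, ζ]λ̃‖² ≤ 9·η⁻⁴·c₀·Σ_{x∈S} Σ_μ [a²·hs(D*_μλ(x)) + a²·hs(D_μλ(x)) + a₂²·hs(λ(x))]` (✓`hs_weighted_comm_le` at `θ = ω = 1`, summed over `S` only).
[cite: Balaban1985BackgroundPropagators, (3.100) pp.413–414, (3.23) p.394; Balaban1984PropagatorsII, p.238] -/
theorem norm_sq_covLapSite_comm_le {a a₂ : ℝ} (S : Finset (Site (F.P K) 0))
    (hζ1 : ∀ (x : Site (F.P K) 0) (μ : Fin 3), |ζ (x.shift μ) - ζ x| ≤ a ∧ |ζ (x.unshift μ) - ζ x| ≤ a)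
    (hζ2 : ∀ (x : Site (F.P K) 0) (μ : Fin 3), |ζ (x.shift μ) + ζ (x.unshift μ) - 2 * ζ x| ≤ a₂)
    (hζS : ∀ x : Site (F.P K) 0, x ∉ S → ∀ μ : Fin 3, ζ (x.shift μ) = ζ x ∧ ζ (x.unshift μ) = ζ x) :
    ‖covLapSite F n K c₀ W (toL2S F K c₀ (fun z => ζ z • l z)) - toL2S F K c₀ (fun x => ζ x • (toL2S F K c₀).symm (covLapSite F n K c₀ W (toL2S F K c₀ l)) x)‖ ^ 2
      ≤ 9 * (((eta F n K)⁻¹) ^ 2) ^ 2 * (c₀ * ∑ x ∈ S, ∑ μ : Fin 3,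
          (a ^ 2 * ∑ j : Fin 2, ∑ k : Fin 2, ‖(covD (torusT (F.P K) 0) (fun μ z => bgUnits F K W ⟨z, μ⟩) μ l (x.unshift μ)) j k‖ ^ 2
            + a ^ 2 * ∑ j : Fin 2, ∑ k : Fin 2, ‖(covD (torusT (F.P K) 0) (fun μ z => bgUnits F K W ⟨z, μ⟩) μ l x) j k‖ ^ 2
            + a₂ ^ 2 * ∑ j : Fin 2, ∑ k : Fin 2, ‖l x j k‖ ^ 2)) := by
  have hc : (0 : ℝ) < c₀ := Fact.out
  have hd3 : ((F.P K).d : ℝ) = 3 := by show ((3 : ℕ) : ℝ) = 3; norm_num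
  -- `hs(D*_μλ(x)) = hs(D_μλ(x − e_μ))` (unitary background)
  have hstar : ∀ (x : Site (F.P K) 0) (μ : Fin 3),
      ∑ j : Fin 2, ∑ k : Fin 2, ‖(covDstar (torusT (F.P K) 0) (fun μ z => bgUnits F K W ⟨z, μ⟩) μ l x) j k‖ ^ 2
        = ∑ j : Fin 2, ∑ k : Fin 2, ‖(covD (torusT (F.P K) 0) (fun μ z => bgUnits F K W ⟨z, μ⟩) μ l (x.unshift μ)) j k‖ ^ 2 := by
    intro x μ
    rw [hs_covDstar_eq (P := F.P K) (i := 0) (U := fun μ z => bgUnits F K W ⟨z, μ⟩) (fun ν z => coe_bgUnits_mem_unitary F K W ν z) μ l x,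
      torusT_symm_apply]
  rw [covLapSite_comm_eq_toL2S, norm_sq_toL2S]
  -- the pointwise letter at `θ = ω = 1`
  have hpt := hs_weighted_comm_le (N := 2) (fun μ z => bgUnits F K W ⟨z, μ⟩) (fun _ => (1 : ℝ)) ζ (fun _ => (1 : ℝ)) l (α := a) (β := a₂)
    (fun _ => zero_le_one) (fun x μ => by simpa only [one_mul, mul_one] using hζ1 x μ) (fun x μ => by simpa only [one_mul, mul_one] using hζ2 x μ)
  simp only [one_pow, one_mul, mul_one, hd3, hstar] at hpt
  -- each site: either in `S` (use the letter) or the commutator vanishes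
  have hsite : ∀ x : Site (F.P K) 0, ∑ j : Fin 2, ∑ k : Fin 2,
      ‖((toL2S F K c₀).symm (covLapSite F n K c₀ W (toL2S F K c₀ (fun z => ζ z • l z))) x
          - ζ x • (toL2S F K c₀).symm (covLapSite F n K c₀ W (toL2S F K c₀ l)) x) j k‖ ^ 2
      ≤ if x ∈ S then (((eta F n K)⁻¹) ^ 2) ^ 2 * (3 * 3 * ∑ μ : Fin 3,
          (a ^ 2 * ∑ j : Fin 2, ∑ k : Fin 2, ‖(covD (torusT (F.P K) 0) (fun μ z => bgUnits F K W ⟨z, μ⟩) μ l (x.unshift μ)) j k‖ ^ 2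
            + a ^ 2 * ∑ j : Fin 2, ∑ k : Fin 2, ‖(covD (torusT (F.P K) 0) (fun μ z => bgUnits F K W ⟨z, μ⟩) μ l x) j k‖ ^ 2
            + a₂ ^ 2 * ∑ j : Fin 2, ∑ k : Fin 2, ‖l x j k‖ ^ 2)) else 0 := by
    intro x
    by_cases hxS : x ∈ S
    · rw [if_pos hxS, covLapSite_comm_apply, hs_smul]
      exact mul_le_mul_of_nonneg_left (hpt x) (sq_nonneg _)
    · rw [if_neg hxS, covLapSite_comm_apply_eq_zero F n K c₀ W ζ l x (hζS x hxS)]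
      simp
  have hsum := Finset.sum_le_sum fun x (_ : x ∈ (Finset.univ : Finset (Site (F.P K) 0))) => hsite x
  rw [Finset.sum_ite_mem, Finset.univ_inter, ← Finset.mul_sum, ← Finset.mul_sum] at hsum
  calc c₀ * _ ≤ c₀ * ((((eta F n K)⁻¹) ^ 2) ^ 2 * (3 * 3 * ∑ x ∈ S, ∑ μ : Fin 3,
          (a ^ 2 * ∑ j : Fin 2, ∑ k : Fin 2, ‖(covD (torusT (F.P K) 0) (fun μ z => bgUnits F K W ⟨z, μ⟩) μ l (x.unshift μ)) j k‖ ^ 2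
            + a ^ 2 * ∑ j : Fin 2, ∑ k : Fin 2, ‖(covD (torusT (F.P K) 0) (fun μ z => bgUnits F K W ⟨z, μ⟩) μ l x) j k‖ ^ 2
            + a₂ ^ 2 * ∑ j : Fin 2, ∑ k : Fin 2, ‖l x j k‖ ^ 2))) := mul_le_mul_of_nonneg_left hsum hc.le
    _ = _ := by ring

end Row1

end Summit.QuantumFields.YangMills.Theorems.Prop7Lane2CutoffCommutators

end
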